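import Literature.Barriers.QuantumAdvantage.BoundedEntanglementGramZUpdate
import Literature.Computability.QuantumComplexity.ZWGalois
import HarnessLib

/-!
# The size of the block data of a `p`-blocked computation: coordinates have `O(h)` bits

Topic `Literature/Barriers/QuantumAdvantage`; arithmetic file of the proof programme for the named
fact `Literature.Barriers.QuantumAdvantage.jozsaLinden2003_pblocked` (Jozsa–Linden 2003, §3). Lemma
`ratlemma` asserts that exact arithmetic stays polynomial because "the number of digits of the
numerator and denominator … grows at most linearly with the number of operations"; for the canonical
block data `gramZ B (ampZ F x j)` of the simulation (`BoundedEntanglementIntegral.lean`) the sharper,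
intrinsic statement holds: every stored number is a matrix element of `2^h ρ_B` for a reduced state
`ρ_B` of a unit vector, both for the circuit and for its Galois conjugate under `√2 ↦ -√2`
(`ω ↦ ω⁵`, the `ζ`-semantics `prodZeta ω⁵` of `CliffordTPathSums.lean`), so by
`ZW.natAbs_le_of_norm_le` (`ZWGalois.lean`) all four coordinates are at most `2 · 2^h` in absolute
value — `h + 2` bits, `h ≤` the number of gates. This is the a-priori register width of the machine.

* `matZeta`, `semZeta_gate` — the `ζ`-semantics of a placed gate symbol as a placement;
  `evalZeta_gateZ`, `evalZeta_applyZ`, `prodZeta_append_singleton`, **`evalZeta_ampZ`**: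
  `evalZeta ζ (ampZ F x j y) = √2^h · (prodZeta ζ (first j gates) |x0…0⟩) y` for `ζ² = i`;
* `cnormSq_evalZeta_ampZ` (`= 2^h` for `ζ ζ̄ = 1`), `evalZeta_gramZ`, `norm_gram_le_normSq`
  (`|⟨x|‖c‖²ρ_B|y⟩| ≤ ‖c‖²`, by `2ab ≤ a² + b²`, no Cauchy–Schwarz needed);
* **`natAbs_gramZ_ampZ_le`**: `|(gramZ B (ampZ F x j) u v)ₖ| ≤ 2 · 2^{hExp F x j}`.

## References

* R. Jozsa, N. Linden, *On the role of entanglement in quantum-computational speed-up*, Proc. R.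
  Soc. Lond. A 459 (2003) 2011–2032, arXiv:quant-ph/0201143: §3, lemma `ratlemma` and the proof
  of lemma `ratpbl` ("assuming that the real numbers in (b) can each be described with poly(m)
  bits of memory").
* L. M. Adleman, J. DeMarrais, M.-D. A. Huang, *Quantum computability*, SIAM J. Comput. 26 (1997),
  §6 (the conjugate-amplitude device, as used in `CliffordTPathSums.lean`).
-/

noncomputable section

namespace Literature.Barriers.QuantumAdvantage

open Finset Matrix Literature.Computability.Cryptography Literature.Computability.QuantumComplexity

variable {N : ℕ}

/-! ### The `ζ`-semantics of a placed gate as a placement -/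

/-- The `ζ`-matrix of a gate symbol: the usual matrix, except `T ↦ diag(1, ζ)`. [folklore] -/
def matZeta (ζ : ℂ) : (op : CliffordTOp) → Matrix (QReg (cliffordT.arity op)) (QReg (cliffordT.arity op)) ℂ
  | .H => hGate
  | .S => sGate
  | .T => phaseGate ζ
  | .CNOT => cnot

/-- `semZeta ζ` of a placed gate symbol is the placement of its `ζ`-matrix. [folklore] -/
theorem semZeta_gate (ζ : ℂ) (op : CliffordTOp) (e : Fin (cliffordT.arity op) ↪ Fin N) :
    semZeta ζ (QGate.gate op e) = placeGate e (matZeta ζ op) := by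
  cases op <;> rfl

/-- **The rescaled gates evaluate at `ζ` to `√2^a ·` the `ζ`-matrices** (`ζ² = i`, `ζ⁴ = -1`). [folklore] -/
theorem evalZeta_gateZ {ζ : ℂ} (hζ2 : ζ ^ 2 = Complex.I) (hζ4 : ζ ^ 4 = -1) (op : CliffordTOp)
    (x y : QReg (cliffordT.arity op)) :
    ZW.evalZeta ζ (gateZ op x y) = (Real.sqrt 2 : ℂ) ^ sqrtTwoExp op * matZeta ζ op x y := by
  cases op with
  | H =>
    change ZW.evalZeta ζ (gateZ .H x y) = (Real.sqrt 2 : ℂ) ^ 1 * hGate x y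
    simp only [gateZ, hGate, Matrix.of_apply, pow_one]
    split_ifs with h
    · rw [← ZW.evalZetaHom_apply, map_neg, ZW.evalZetaHom_apply, ZW.evalZeta_one, mul_neg, ← invSqrt2,
        sqrt2_mul_invSqrt2]
    · rw [ZW.evalZeta_one, ← invSqrt2, sqrt2_mul_invSqrt2]
  | S =>
    change ZW.evalZeta ζ (gateZ .S x y) = (Real.sqrt 2 : ℂ) ^ 0 * sGate x y
    simp only [gateZ, sGate, Matrix.of_apply, pow_zero, one_mul]
    split_ifs <;> simp [ZW.evalZeta_mulOmegaPow_one hζ4, hζ2]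
  | T =>
    change ZW.evalZeta ζ (gateZ .T x y) = (Real.sqrt 2 : ℂ) ^ 0 * phaseGate ζ x y
    simp only [gateZ, phaseGate, Matrix.of_apply, pow_zero, one_mul]
    split_ifs <;> simp [ZW.evalZeta_mulOmegaPow_one hζ4]
  | CNOT =>
    change ZW.evalZeta ζ (gateZ .CNOT x y) = (Real.sqrt 2 : ℂ) ^ 0 * cnot x y
    simp only [gateZ, cnot, Matrix.of_apply, pow_zero, one_mul]
    split_ifs <;> simp

/-- **`applyZ` evaluates at `ζ` to the rescaled `ζ`-semantics**: if `evalZeta ζ ∘ c = v` then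
`evalZeta ζ ((applyZ g c) y) = √2^{qScale g} · (semZeta ζ g v) y` for an oracle-free gate `g`. [folklore] -/
theorem evalZeta_applyZ {ζ : ℂ} (hζ2 : ζ ^ 2 = Complex.I) (hζ4 : ζ ^ 4 = -1) {g : QGate cliffordT N}
    (hg : g.IsOracleFree) {c : QReg N → ZW} {v : QReg N → ℂ} (hcv : ∀ y, ZW.evalZeta ζ (c y) = v y)
    (y : QReg N) : ZW.evalZeta ζ (applyZ g c y) = (Real.sqrt 2 : ℂ) ^ qScale g * (semZeta ζ g *ᵥ v) y := by
  cases g with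
  | oracle k e => exact absurd hg id
  | gate op e =>
    simp only [applyZ, qScale, semZeta_gate]
    rw [placeGate_mulVec_apply, ZW.evalZeta_sum, Finset.mul_sum]
    refine sum_congr rfl fun z _ => ?_
    rw [ZW.evalZeta_mul hζ4, evalZeta_gateZ hζ2 hζ4, hcv]
    ring

/-- `dpInit` evaluates at any `ζ` to `basisState`. [folklore] -/
theorem evalZeta_dpInit (ζ : ℂ) (w y : QReg N) : ZW.evalZeta ζ (dpInit w y) = basisState w y := by
  unfold dpInit
  rw [basisState_apply]
  split_ifs <;> simp

/-- Appending a gate to `prodZeta`: it is the leftmost factor. [folklore] -/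
theorem prodZeta_append_singleton (ζ : ℂ) (gs : List (QGate cliffordT N)) (g : QGate cliffordT N) :
    prodZeta ζ (gs ++ [g]) = semZeta ζ g * prodZeta ζ gs := by
  simp [prodZeta]

section Family

variable (F : QCircuitFamily cliffordT) (x : List Bool)

/-- **The integral amplitudes evaluate at `ζ` to the rescaled `ζ`-semantics of the prefix**:
`evalZeta ζ (ampZ F x j y) = √2 ^ hExp F x j · (prodZeta ζ (first j gates) |x 0…0⟩) y` (`ζ² = i`).
For `ζ = ω` this is `zwVal_ampZ`; for `ζ = ω⁵` the Galois conjugate data. [folklore] -/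
theorem evalZeta_ampZ {ζ : ℂ} (hζ2 : ζ ^ 2 = Complex.I) (hζ4 : ζ ^ 4 = -1) (hF : F.IsOracleFree) (j : ℕ)
    (y : QReg (x.length + F.ancillas x.length)) :
    ZW.evalZeta ζ (F.ampZ x j y) = (Real.sqrt 2 : ℂ) ^ F.hExp x j *
      (prodZeta ζ ((F.circ x.length).gates.take j) *ᵥ basisState (padInput x.get (F.ancillas x.length))) y := by
  induction j generalizing y with
  | zero =>
    rw [ampZ_zero, hExp_zero, evalZeta_dpInit, pow_zero, one_mul, List.take_zero, prodZeta_nil, Matrix.one_mulVec]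
  | succ j ih =>
    by_cases hj : j < (F.circ x.length).gates.length
    · rw [ampZ_succ F x hj, hExp_succ F x hj, List.take_succ_eq_append_getElem hj, prodZeta_append_singleton,
        ← Matrix.mulVec_mulVec,
        evalZeta_applyZ hζ2 hζ4 (hF x.length _ (List.getElem_mem hj))
          (v := ((Real.sqrt 2 : ℂ) ^ F.hExp x j) •
            (prodZeta ζ ((F.circ x.length).gates.take j) *ᵥ basisState (padInput x.get (F.ancillas x.length))))
          (fun y => by rw [ih y, Pi.smul_apply, smul_eq_mul]),
        Matrix.mulVec_smul, Pi.smul_apply, smul_eq_mul, pow_add]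
      ring
    · push Not at hj
      rw [ampZ_of_length_le F x (Nat.le_succ_of_le hj), hExp_of_length_le F x (Nat.le_succ_of_le hj),
        List.take_of_length_le (Nat.le_succ_of_le hj), ← ampZ_of_length_le F x hj, ← hExp_of_length_le F x hj,
        ← List.take_of_length_le hj]
      exact ih y

/-- **`‖evalZeta ζ ∘ ampZ‖² = 2^h`** for `ζ ζ̄ = 1`, `ζ² = i` (both `ω` and `ω⁵`). [folklore] -/
theorem normSq_evalZeta_ampZ {ζ : ℂ} (hζ : ζ * star ζ = 1) (hζ2 : ζ ^ 2 = Complex.I) (hζ4 : ζ ^ 4 = -1)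
    (hF : F.IsOracleFree) (j : ℕ) :
    normSq (fun y => ZW.evalZeta ζ (F.ampZ x j y)) = (2 : ℝ) ^ F.hExp x j := by
  have hfun : (fun y => ZW.evalZeta ζ (F.ampZ x j y)) = ((Real.sqrt 2 : ℂ) ^ F.hExp x j) •
      (prodZeta ζ ((F.circ x.length).gates.take j) *ᵥ basisState (padInput x.get (F.ancillas x.length))) := by
    funext y
    rw [evalZeta_ampZ F x hζ2 hζ4 hF j y, Pi.smul_apply, smul_eq_mul]
  have hc := cnormSq_smul ((Real.sqrt 2 : ℂ) ^ F.hExp x j)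
    (prodZeta ζ ((F.circ x.length).gates.take j) *ᵥ basisState (padInput x.get (F.ancillas x.length)))
  rw [← hfun, cnormSq_eq_normSq, cnormSq_eq_normSq, normSq_prodZeta_mulVec_basisState hζ,
    sqrt_two_pow_mul_conj, Complex.ofReal_one, mul_one] at hc
  exact_mod_cast hc

end Family

/-! ### Gram data are bounded by the squared norm, at `ω` and at `ω⁵` -/

/-- **Integral Gram data evaluate at `ζ` to Gram data** (`ζ⁴ = -1`, `conj ζ = -ζ³`). [folklore] -/
theorem evalZeta_gramZ {ζ : ℂ} (hζ4 : ζ ^ 4 = -1) (hc : starRingEnd ℂ ζ = -ζ ^ 3) (B : Finset (Fin N))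
    (c : QReg N → ZW) (x y : QReg N) :
    ZW.evalZeta ζ (gramZ B c x y) = gram B (fun w => ZW.evalZeta ζ (c w)) x y := by
  unfold gramZ gram
  rw [ZW.evalZeta_sum]
  exact sum_congr rfl fun r _ => by rw [ZW.evalZeta_mul hζ4, ZW.evalZeta_cconj hζ4 hc]

/-- Gluing along `B` is injective on the configurations vanishing on `B`. [folklore] -/
theorem piecewise_injOn_cfg_compl (B : Finset (Fin N)) (x : QReg N) :
    Set.InjOn (fun r : QReg N => B.piecewise x r) (cfg Bᶜ : Set (QReg N)) := by
  intro r hr r' hr' h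
  have h' : B.piecewise x r = B.piecewise x r' := h
  funext i
  by_cases hi : i ∈ B
  · rw [mem_coe, mem_cfg] at hr hr'
    rw [hr i (fun h => (mem_compl.1 h) hi), hr' i (fun h => (mem_compl.1 h) hi)]
  · have := congrFun h' i
    rwa [piecewise_eq_of_notMem _ _ _ hi, piecewise_eq_of_notMem _ _ _ hi] at this

/-- A slice carries at most the whole squared norm. [folklore] -/
theorem sum_cfg_normSq_slice_le (B : Finset (Fin N)) (c : QReg N → ℂ) (x : QReg N) :
    ∑ r ∈ cfg Bᶜ, ‖c (B.piecewise x r)‖ ^ 2 ≤ normSq c := by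
  classical
  unfold normSq
  rw [← Finset.sum_image (f := fun w => ‖c w‖ ^ 2) (piecewise_injOn_cfg_compl B x)]
  exact Finset.sum_le_sum_of_subset_of_nonneg (subset_univ _) fun _ _ _ => by positivity

/-- **`|⟨x| ‖c‖² ρ_B |y⟩| ≤ ‖c‖²`**: a Gram datum is bounded by the squared norm (`2|ab| ≤ |a|² + |b|²`).
[cite: JozsaLinden2003, §3 (proof of lemma ratpbl: the block data are reduced states)] -/
theorem norm_gram_le_normSq (B : Finset (Fin N)) (c : QReg N → ℂ) (x y : QReg N) :
    ‖gram B c x y‖ ≤ normSq c := by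
  unfold gram
  refine (norm_sum_le _ _).trans ?_
  have hterm : ∀ r ∈ cfg Bᶜ, ‖c (B.piecewise x r) * starRingEnd ℂ (c (B.piecewise y r))‖ ≤
      (‖c (B.piecewise x r)‖ ^ 2 + ‖c (B.piecewise y r)‖ ^ 2) / 2 := by
    intro r _
    rw [norm_mul, Complex.norm_conj]
    nlinarith [sq_nonneg (‖c (B.piecewise x r)‖ - ‖c (B.piecewise y r)‖)]
  refine (Finset.sum_le_sum hterm).trans ?_
  rw [← Finset.sum_div, Finset.sum_add_distrib]
  have h1 := sum_cfg_normSq_slice_le B c x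
  have h2 := sum_cfg_normSq_slice_le B c y
  linarith

section Family

variable (F : QCircuitFamily cliffordT) (x : List Bool)

/-- **The block data have coordinates of absolute value at most `2 · 2^h`** (`h` the Hadamard count):
`|(gramZ B (ampZ F x j) u v)ₖ| ≤ 2 · 2^{hExp F x j}` — the values and their Galois conjugates are Gram
data of unit vectors rescaled by `2^h`. [cite: JozsaLinden2003, §3 (lemma ratlemma; proof of lemma ratpbl (b))] -/
theorem natAbs_gramZ_ampZ_le (hF : F.IsOracleFree) (j : ℕ) (B : Finset (Fin (x.length + F.ancillas x.length)))
    (u v : QReg (x.length + F.ancillas x.length)) (k : Fin 4) :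
    ((gramZ B (F.ampZ x j) u v) k).natAbs ≤ 2 * 2 ^ F.hExp x j := by
  have h1 : ‖ZW.zwVal (gramZ B (F.ampZ x j) u v)‖ ≤ ((2 ^ F.hExp x j : ℕ) : ℝ) := by
    rw [ZW.zwVal_eq_evalZeta, evalZeta_gramZ omega_pow_four conj_omega]
    refine (norm_gram_le_normSq _ _ _ _).trans (le_of_eq ?_)
    push_cast
    exact normSq_evalZeta_ampZ F x omega_mul_star omega_pow_two omega_pow_four hF j
  have h2 : ‖ZW.evalZeta (omega ^ 5) (gramZ B (F.ampZ x j) u v)‖ ≤ ((2 ^ F.hExp x j : ℕ) : ℝ) := by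
    rw [evalZeta_gramZ omega5_pow_four conj_omega5]
    refine (norm_gram_le_normSq _ _ _ _).trans (le_of_eq ?_)
    push_cast
    exact normSq_evalZeta_ampZ F x omega5_mul_star omega5_pow_two omega5_pow_four hF j
  exact ZW.natAbs_le_of_norm_le h1 h2 k

end Family

end Literature.Barriers.QuantumAdvantage

end
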